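import Literature.Analysis.PDE.ABPPointwise
import HarnessLib

/-!
# Affine changes of variable for Hessian matrices (for GT's "transformation x → α(x-z)/r")

For the affine map `T(x) = z + c • x` (`c : ℝ`) on a real inner product space and `u`
differentiable near `T x` with `Du` differentiable at `T x`:
`D(u ∘ T)(x) = c • Du(Tx)`, `D²(u ∘ T)(x)(v)(w) = c² D²u(Tx)(v)(w)`, hence
`hessianMatrix (u ∘ T) b x = c² • hessianMatrix u b (T x)` (`hessianMatrix_comp_affine`), and the
regularity of `u ∘ T` (`contDiffOn_comp_affine`). This is the calculus behind the rescaling step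
"using the transformation `x → α(x - z)/r`" in Gilbarg–Trudinger's proof of Theorem 9.22.

## References

* D. Gilbarg, N. S. Trudinger, *Elliptic Partial Differential Equations of Second Order* (2001),
  proof of Theorem 9.22 (before (9.55)). [GilbargTrudinger2001]
-/

noncomputable section

open Set InnerProductSpace Matrix Filter Metric
open scoped Topology

namespace Literature.Analysis.PDE.KrylovSafonov

open Literature.Analysis.PDE.ABP

variable {E : Type*} [NormedAddCommGroup E] [InnerProductSpace ℝ E]
  {ι : Type*} [Fintype ι] [DecidableEq ι]

/-- The affine map `T_{z,c}(x) = z + c • x`. [folklore] -/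
def affineMap (z : E) (c : ℝ) (x : E) : E := z + c • x

omit [Fintype ι] [DecidableEq ι] in
/-- `T` has derivative `c • id`. [folklore] -/
theorem hasFDerivAt_affineMap (z : E) (c : ℝ) (x : E) :
    HasFDerivAt (affineMap z c) (c • ContinuousLinearMap.id ℝ E) x := by
  unfold affineMap
  exact ((ContinuousLinearMap.id ℝ E).hasFDerivAt.const_smul c).const_add z

omit [Fintype ι] [DecidableEq ι] in
/-- `T` is smooth. [folklore] -/
theorem contDiff_affineMap (z : E) (c : ℝ) : ContDiff ℝ ⊤ (affineMap z c) := by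
  unfold affineMap; fun_prop

omit [Fintype ι] [DecidableEq ι] in
/-- **First derivative of `u ∘ T`**: `D(u∘T)(x) = c • Du(Tx)`. [folklore] -/
theorem hasFDerivAt_comp_affineMap {u : E → ℝ} {z : E} {c : ℝ} {x : E}
    (hu : DifferentiableAt ℝ u (affineMap z c x)) :
    HasFDerivAt (u ∘ affineMap z c) (c • fderiv ℝ u (affineMap z c x)) x := by
  have h := hu.hasFDerivAt.comp x (hasFDerivAt_affineMap z c x)
  refine h.congr_fderiv ?_
  ext v
  simp

omit [Fintype ι] [DecidableEq ι] in
/-- `fderiv (u ∘ T)` near a point. [folklore] -/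
theorem fderiv_comp_affineMap_eventuallyEq {u : E → ℝ} {z : E} {c : ℝ} {x : E}
    (hu : ∀ᶠ y in 𝓝 (affineMap z c x), DifferentiableAt ℝ u y) :
    fderiv ℝ (u ∘ affineMap z c) =ᶠ[𝓝 x] fun y ↦ c • fderiv ℝ u (affineMap z c y) := by
  have hT : ContinuousAt (affineMap z c) x := (contDiff_affineMap z c).continuous.continuousAt
  filter_upwards [hT.preimage_mem_nhds hu] with y hy
  exact (hasFDerivAt_comp_affineMap hy).fderiv

omit [Fintype ι] [DecidableEq ι] in
/-- **Second derivative of `u ∘ T`**: `D²(u∘T)(x) = c • (D²u(Tx) ∘ (c • id))`. [folklore] -/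
theorem hasFDerivAt_fderiv_comp_affineMap {u : E → ℝ} {z : E} {c : ℝ} {x : E}
    (hu : ∀ᶠ y in 𝓝 (affineMap z c x), DifferentiableAt ℝ u y)
    (hu2 : DifferentiableAt ℝ (fderiv ℝ u) (affineMap z c x)) :
    HasFDerivAt (fderiv ℝ (u ∘ affineMap z c))
      (c • ((fderiv ℝ (fderiv ℝ u) (affineMap z c x)).comp (c • ContinuousLinearMap.id ℝ E))) x := by
  have h1 : HasFDerivAt (fun y ↦ fderiv ℝ u (affineMap z c y))
      ((fderiv ℝ (fderiv ℝ u) (affineMap z c x)).comp (c • ContinuousLinearMap.id ℝ E)) x :=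
    hu2.hasFDerivAt.comp x (hasFDerivAt_affineMap z c x)
  exact (h1.const_smul c).congr_of_eventuallyEq (fderiv_comp_affineMap_eventuallyEq hu)

omit [Fintype ι] [DecidableEq ι] in
/-- The second derivative of `u ∘ T`, evaluated: `c² D²u(Tx)(v)(w)`. [folklore] -/
theorem fderiv_fderiv_comp_affineMap_apply {u : E → ℝ} {z : E} {c : ℝ} {x : E}
    (hu : ∀ᶠ y in 𝓝 (affineMap z c x), DifferentiableAt ℝ u y)
    (hu2 : DifferentiableAt ℝ (fderiv ℝ u) (affineMap z c x)) (v w : E) :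
    fderiv ℝ (fderiv ℝ (u ∘ affineMap z c)) x v w =
      c ^ 2 * fderiv ℝ (fderiv ℝ u) (affineMap z c x) v w := by
  rw [(hasFDerivAt_fderiv_comp_affineMap hu hu2).fderiv]
  simp
  ring

omit [DecidableEq ι] in
/-- **The Hessian matrix under an affine change of variables**:
`H_{u∘T}(x) = c² H_u(Tx)`. [cite: GilbargTrudinger2001, proof of Thm 9.22 (rescaling)] -/
theorem hessianMatrix_comp_affineMap {u : E → ℝ} {z : E} {c : ℝ} {x : E}
    (b : OrthonormalBasis ι ℝ E) (hu : ∀ᶠ y in 𝓝 (affineMap z c x), DifferentiableAt ℝ u y)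
    (hu2 : DifferentiableAt ℝ (fderiv ℝ u) (affineMap z c x)) :
    hessianMatrix (u ∘ affineMap z c) b x = c ^ 2 • hessianMatrix u b (affineMap z c x) := by
  ext i j
  simp [hessianMatrix_apply, fderiv_fderiv_comp_affineMap_apply hu hu2]

omit [Fintype ι] [DecidableEq ι] in
/-- **Regularity of `u ∘ T`.** [folklore] -/
theorem contDiffOn_comp_affineMap {u : E → ℝ} {U : Set E} {n : WithTop ℕ∞} (hu : ContDiffOn ℝ n u U)
    (z : E) (c : ℝ) : ContDiffOn ℝ n (u ∘ affineMap z c) (affineMap z c ⁻¹' U) :=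
  hu.comp ((contDiff_affineMap z c).of_le le_top).contDiffOn (fun _ hx ↦ hx)

omit [Fintype ι] [DecidableEq ι] in
/-- `T` maps `B(0, s)` into `B(z, |c| s)`; precisely `‖T x - z‖ = |c| ‖x‖`. [folklore] -/
theorem norm_affineMap_sub (z : E) (c : ℝ) (x : E) : ‖affineMap z c x - z‖ = |c| * ‖x‖ := by
  rw [affineMap, add_sub_cancel_left, norm_smul, Real.norm_eq_abs]

omit [Fintype ι] [DecidableEq ι] in
/-- Preimage of the positivity/open sets: `T ⁻¹' U` is open for open `U`. [folklore] -/
theorem isOpen_preimage_affineMap {U : Set E} (hU : IsOpen U) (z : E) (c : ℝ) :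
    IsOpen (affineMap z c ⁻¹' U) :=
  hU.preimage (contDiff_affineMap z c).continuous

end Literature.Analysis.PDE.KrylovSafonov

end
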